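import Summits.QuantumFields.YangMills.Theorems.BalabanUVNodesN12BjRootChains
import HarnessLib

/-!
# BalabanUVNodes ∕ N12 — THE ROOT CHAINS OF `𝐁_k(Z)`, GRADED BY LEVEL: every link of the chain joining the roots of a fine bond whose ends have `Γ`-levels `J`, `J′` (`|J − J′| ≤ 1`) is a
# member bond of level `≤ min(J, J′) + 1` — so the chain's fine length is `≤ m·L^{J+1}`, not merely `≤ m·L^k` (dag-n12-w6's LOCATED-GRADING ∕ dag-n12-c's LOCATED-PLAQ: the plaquette boxes
# read by the Stokes bounds of [Balaban1985Variational] (16)–(18) must stay inside the printed collars `L^J M₁` of [III] (2.13))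

Cell `pub-ymgap` (HUMAN RULINGS D-0062 ∕ D-0149), WIDTH SEAT `pub-ymgap-dag-n12-w3` g4 (node N12 = [B15]; key K1⁹ `stmt-QuantumFields-27364` (KEY MAP v2), `--kind proof --supports … --as
helper`; count-neutral).  THEOREMS ONLY (0 `def`, 0 `instance`, 0 `sorry`); the graded twins of `N12BjRootChains` (same constructions, the level of every link tracked), over
`N12BjAcrossChains.exists_chain_across_graded` (v1.1).

WHY (cell bus 2026-08-28, dag-n12-w6 g2 LOCATED-GRADING, agreed by the lane owner dag-n12-c g19): with a UNIFORM transporter budget `ℓT ∼ L^k` the plaquette boxes around the roots of the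
sites of a `Γ₁`-block at `∂Ω₁` would have radius `∼ L^k`, far beyond the level-1 collar `L·M₁`; print is graded ([6] (1.7), [15] (2): everything at level `j` lives on scale `L^j` inside
`Ω_j`).  The root chains ARE graded by construction: the chain of a bond with end levels `J`, `J′` uses the straddling members and in-block paths of levels `J − 1`, `J` (root ⇝ centre), one
member of level `≤ max(J, J′)` or a crossing at levels `min, min + 1` (centre ⇝ centre), and levels `J′ − 1`, `J′` (centre ⇝ root): all `≤ min(J, J′) + 1`.  THIS FILE records it:
★★ `exists_chain_root_centre_graded` (grade `≤ J`), ★★ `exists_chain_centre_centre_graded` (`|J − J′| ≤ 1` exported; grade `≤ J + 1` and `≤ J′ + 1`), ★★★ `exists_rootChain_Bj_graded`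
(levels of the two ends as inputs; grade `≤ J + 1 ∧ ≤ J′ + 1` for every link, membership and the `pre ++ l :: post` consecutiveness as before).

HONEST FRAMING.  Lattice bookkeeping by name; no analysis; nothing of Bałaban's asserted; N12 NOT discharged; K1⁹ NOT closed; counts unmoved (typed 28∕28 · discharged 5∕27); one
finite 𝕋⁴ programme at fixed ε — R4 closes the conditional rung `BalabanLadder.UV` only; the Yang–Mills mass gap (Clay) is NOT proved by any of this; nothing continuum ∕ ℝ⁴ ∕ OS.
-/

noncomputable section

namespace Summit.QuantumFields.YangMills.BalabanUVNodes.N12BjRootChainsGraded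

open scoped BigOperators
open Literature.MathematicalPhysics.QuantumFieldTheory.Balaban1983to89
open T4Continuum
open B15DeterminingSets
open B5Eq118OneStroke (iterBlockOf iterBlockOf_succ)
open B14.Eq213MaximalDomains (side)
open B14.Eq213DetSet (Bj Bj_zero Bj_mid Bj_top Bj_of_gt maxDomT maxDomT_antitone)
open Literature.MathematicalPhysics.QuantumFieldTheory.BalabanImbrieJaffe1984to88.BIJ88RT51Background (iterBlockOf_embIter)
open Summit.QuantumFields.YangMills.BalabanUVNodes.N07CritMultiScaleLamBond (iterBlockOf_congr_of_le)
open Summit.QuantumFields.YangMills.BalabanUVNodes.N12FlatHndRecordLetters (hcov_Bj)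
open Summit.QuantumFields.YangMills.BalabanUVNodes.N12BjCollarRoots
open Summit.QuantumFields.YangMills.BalabanUVNodes.N12BlockChains
open Summit.QuantumFields.YangMills.BalabanUVNodes.N12BjAcrossChains
open B6CubeRightLegsV1 (iterBlockOf_shift_or)

variable {P : Params}

/-! ## §1 Root ⇝ centre, graded -/

section RootCentre

variable {M₁ k : ℕ} {Z : Set (Site P 0)}

/-- ★★ **(graded) ROOT ⇝ CENTRE AND CENTRE ⇝ ROOT** — `N12BjRootChains.exists_chain_root_centre` with the LEVEL GRADE `≤ J` of every link recorded (levels `J − 1`, `J`).  For a site `z` whose `J`-block is a member (`J ≥ 1`, `M₁ ≥ 2`) and a root value given by p635000's (CENTRE) clause — `ι_{J−1}(B^{J−1} z)` on the face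
layer (the `(J−1)`-block of `z` an end of a member `(J−1)`-bond), `ι_J(B^J z)` otherwise — chains of `≤ d·(L−1)∕2 + 2` member links join `root z` to the block's centre `ι_J(B^J z)` and back:
empty off the face layer; on it the straddling member `(J−1)`-bond to the outside neighbour block, a path of level-`(J−1)` members inside that block to its centre, and the member `J`-bond back
to `B^J z` (`exists_chain_across`). [cite: Balaban1988Convergent, (2.2) p.255, (2.13) pp.256–257; Balaban1985Variational, (3)–(4) p.278, (16)–(18) p.280] -/
theorem exists_chain_root_centre_graded (hM2 : 2 ≤ M₁) (hdiv : side P.L M₁ k ∣ P.sitesPerDir 0) (hk : k ≤ P.m + P.K) {J : ℕ} (hJ1 : 1 ≤ J)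
    {z : Site P 0} (hz : iterBlockOf J z ∈ (Bj M₁ Z k : DetSet P) J) (root : Site P 0 → Site P 0)
    (hcentre : ((1 ≤ J ∧ ∃ c ∈ bondsOf ((Bj M₁ Z k : DetSet P) (J - 1)), (iterBlockOf (J - 1) z = c.src ∨ iterBlockOf (J - 1) z = c.tgt)) ∧
        root z = embIter (J - 1) (iterBlockOf (J - 1) z)) ∨
      (¬ (1 ≤ J ∧ ∃ c ∈ bondsOf ((Bj M₁ Z k : DetSet P) (J - 1)), (iterBlockOf (J - 1) z = c.src ∨ iterBlockOf (J - 1) z = c.tgt)) ∧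
        root z = embIter J (iterBlockOf J z))) :
    (∃ links : List ((m : ℕ) × (PBond P m × Bool)), links.length ≤ P.d * ((P.L - 1) / 2) + 2 ∧
      (∀ l ∈ links, l.1 ≤ J ∧ l.1 ≤ k ∧ l.2.1 ∈ bondsOf ((Bj M₁ Z k : DetSet P) l.1)) ∧
      walkEnd (root z) (links.map fun l => List.replicate (P.L ^ l.1) (l.2.1.dir, l.2.2)).flatten = embIter J (iterBlockOf J z) ∧
      ∀ (pre post : List ((m : ℕ) × (PBond P m × Bool))) (l : (m : ℕ) × (PBond P m × Bool)), links = pre ++ l :: post →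
        (l.2.2 = true → walkEnd (root z) (pre.map fun l => List.replicate (P.L ^ l.1) (l.2.1.dir, l.2.2)).flatten = embIter l.1 l.2.1.src) ∧
        (l.2.2 = false → walkEnd (root z) (pre.map fun l => List.replicate (P.L ^ l.1) (l.2.1.dir, l.2.2)).flatten = embIter l.1 l.2.1.tgt)) ∧
    (∃ links : List ((m : ℕ) × (PBond P m × Bool)), links.length ≤ P.d * ((P.L - 1) / 2) + 2 ∧
      (∀ l ∈ links, l.1 ≤ J ∧ l.1 ≤ k ∧ l.2.1 ∈ bondsOf ((Bj M₁ Z k : DetSet P) l.1)) ∧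
      walkEnd (embIter J (iterBlockOf J z)) (links.map fun l => List.replicate (P.L ^ l.1) (l.2.1.dir, l.2.2)).flatten = root z ∧
      ∀ (pre post : List ((m : ℕ) × (PBond P m × Bool))) (l : (m : ℕ) × (PBond P m × Bool)), links = pre ++ l :: post →
        (l.2.2 = true → walkEnd (embIter J (iterBlockOf J z)) (pre.map fun l => List.replicate (P.L ^ l.1) (l.2.1.dir, l.2.2)).flatten = embIter l.1 l.2.1.src) ∧
        (l.2.2 = false → walkEnd (embIter J (iterBlockOf J z)) (pre.map fun l => List.replicate (P.L ^ l.1) (l.2.1.dir, l.2.2)).flatten = embIter l.1 l.2.1.tgt)) := by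
  have hM : 1 ≤ M₁ := by omega
  have hJk : J ≤ k := le_of_iterBlockOf_mem_Bj hz
  rcases hcentre with ⟨⟨-, c₀, hc₀, hy₀⟩, hroot₀⟩ | ⟨-, hroot⟩
  swap
  · -- off the face layer: the root IS the centre
    rw [hroot]
    refine ⟨⟨[], by simp, fun l hl => absurd hl List.not_mem_nil, rfl, fun pre post l h => ?_⟩,
      ⟨[], by simp, fun l hl => absurd hl List.not_mem_nil, rfl, fun pre post l h => ?_⟩⟩ <;> simp at h
  · -- the face layer
    obtain ⟨n, rfl⟩ : ∃ n, J = n + 1 := ⟨J - 1, by omega⟩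
    -- `n + 1 - 1` is `n` by computation: re-read the face-layer data at level `n`
    obtain ⟨c, hc, hy⟩ : ∃ c : PBond P n, c ∈ bondsOf ((Bj M₁ Z k : DetSet P) n) ∧ (iterBlockOf n z = c.src ∨ iterBlockOf n z = c.tgt) := ⟨c₀, hc₀, hy₀⟩
    have hroot : root z = embIter n (iterBlockOf n z) := hroot₀
    clear hc₀ hy₀ hroot₀ c₀
    have hn1 : n + 1 ≤ P.m + P.K := hJk.trans hk
    -- the `n`-block `y` of `z` is NOT a member of level `n` (its level is `n + 1`); the other end `q` of `c` is
    have hyn : iterBlockOf n z ∉ (Bj M₁ Z k : DetSet P) n := fun h => absurd (eq_of_iterBlockOf_mem_Bj hM hdiv hk h hz) (by omega)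
    -- `q`, the orientation `o` of `c` from `y` to `q`, and the facts
    obtain ⟨q, o, hq, hyo, hqo⟩ : ∃ (q : Site P n) (o : Bool), q ∈ (Bj M₁ Z k : DetSet P) n ∧
        ((o = true → iterBlockOf n z = c.src ∧ q = c.tgt) ∧ (o = false → iterBlockOf n z = c.tgt ∧ q = c.src)) ∧ (q = c.src ∨ q = c.tgt) := by
      rcases hy with hy | hy
      · refine ⟨c.tgt, true, ?_, ⟨fun _ => ⟨hy, rfl⟩, fun h => absurd h (by simp)⟩, Or.inr rfl⟩
        rcases hc with h | h
        · exact absurd (hy ▸ h) hyn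
        · exact h
      · refine ⟨c.src, false, ?_, ⟨fun h => absurd h (by simp), fun _ => ⟨hy, rfl⟩⟩, Or.inl rfl⟩
        rcases hc with h | h
        · exact h
        · exact absurd (hy ▸ h) hyn
    -- `w = ι_n q` lies outside `Ω_{n+1}`, in the `(n+1)`-block `blockOf q` adjacent to `B^{n+1} z`
    have hw : embIter n q ∉ maxDomT M₁ Z (n + 1) := embIter_not_mem_maxDomT_succ hM2 hdiv hk hJk hq
    have hqw : iterBlockOf n (embIter n q) = q := iterBlockOf_embIter n (by omega) q
    have hBw : iterBlockOf (n + 1) (embIter n q) = blockOf q := by rw [iterBlockOf_succ, hqw]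
    have hne : blockOf q ≠ iterBlockOf (n + 1) z := fun h =>
      iterBlockOf_ne_of_mem_not_mem hM2 hdiv hk (by omega) hJk (mem_maxDomT_of_iterBlockOf_mem_Bj hM hdiv hk (by omega) hz) hw (by rw [hBw, h])
    obtain ⟨C, hC⟩ : ∃ C : PBond P (n + 1), (C.src = iterBlockOf (n + 1) z ∧ C.tgt = iterBlockOf (n + 1) (embIter n q)) ∨
        (C.tgt = iterBlockOf (n + 1) z ∧ C.src = iterBlockOf (n + 1) (embIter n q)) := by
      have hor := blockOf_shift_or hn1 c.src c.dir
      have htgt : (c.tgt : Site P n) = c.src.shift c.dir := rfl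
      cases ho : o
      · obtain ⟨hy', hq'⟩ := hyo.2 ho
        -- `y = c.tgt`, `q = c.src`: `blockOf y = blockOf q + e_dir`
        refine ⟨⟨blockOf c.src, c.dir⟩, Or.inr ⟨?_, by rw [hBw, hq']⟩⟩
        show (blockOf c.src).shift c.dir = iterBlockOf (n + 1) z
        rw [iterBlockOf_succ, hy', htgt]
        rcases hor with h | h
        · exact absurd (by rw [hq', ← h, ← htgt, ← hy']; rfl) hne
        · exact h.symm
      · obtain ⟨hy', hq'⟩ := hyo.1 ho
        -- `y = c.src`, `q = c.tgt`: `blockOf q = blockOf y + e_dir`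
        refine ⟨⟨blockOf c.src, c.dir⟩, Or.inl ⟨by rw [iterBlockOf_succ, hy'], ?_⟩⟩
        show (blockOf c.src).shift c.dir = iterBlockOf (n + 1) (embIter n q)
        rw [hBw, hq', htgt]
        rcases hor with h | h
        · exact absurd (by rw [hq', htgt, h, ← hy']; rfl) hne
        · exact h.symm
    obtain ⟨-, ⟨LB, hLBlen, hLBmem, hLBend, hLBcons⟩, ⟨LC, hLClen, hLCmem, hLCend, hLCcons⟩⟩ := exists_chain_across_graded hM2 hdiv hk hJk hz hw C hC
    rw [hqw] at hLBend hLCend hLCcons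
    have hcmem : n ≤ n + 1 ∧ n ≤ k ∧ c ∈ bondsOf ((Bj M₁ Z k : DetSet P) n) := ⟨Nat.le_succ n, by omega, hc⟩
    -- the straddling link `c`: from `root z = ι_n y` to `ι_n q` (orientation `o`), and back (orientation `!o`)
    have hst1 : ((⟨n, c, o⟩ : (m : ℕ) × (PBond P m × Bool)).2.2 = true → root z = embIter n c.src) ∧
        ((⟨n, c, o⟩ : (m : ℕ) × (PBond P m × Bool)).2.2 = false → root z = embIter n c.tgt) :=
      ⟨fun h => by rw [hroot, (hyo.1 h).1], fun h => by rw [hroot, (hyo.2 h).1]⟩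
    have hen1 : walkEnd (root z) ([(⟨n, c, o⟩ : (m : ℕ) × (PBond P m × Bool))].map fun l => List.replicate (P.L ^ l.1) (l.2.1.dir, l.2.2)).flatten = embIter n q := by
      rw [walkEnd_single ⟨n, c, o⟩ _ hst1]
      cases ho : o
      · rw [(hyo.2 ho).2]; simp
      · rw [(hyo.1 ho).2]; simp
    have hst2 : ((⟨n, c, !o⟩ : (m : ℕ) × (PBond P m × Bool)).2.2 = true → embIter n q = embIter n c.src) ∧
        ((⟨n, c, !o⟩ : (m : ℕ) × (PBond P m × Bool)).2.2 = false → embIter n q = embIter n c.tgt) :=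
      ⟨fun h => by rw [(hyo.2 (by simpa using h)).2], fun h => by rw [(hyo.1 (by simpa using h)).2]⟩
    have hen2 : walkEnd (embIter n q) ([(⟨n, c, !o⟩ : (m : ℕ) × (PBond P m × Bool))].map fun l => List.replicate (P.L ^ l.1) (l.2.1.dir, l.2.2)).flatten = root z := by
      rw [walkEnd_single ⟨n, c, !o⟩ _ hst2, hroot]
      cases ho : o
      · rw [(hyo.2 ho).1]; simp
      · rw [(hyo.1 ho).1]; simp
    refine ⟨⟨[⟨n, c, o⟩] ++ LC, ?_, ?_, ?_, ?_⟩, ⟨LB ++ [⟨n, c, !o⟩], ?_, ?_, ?_, ?_⟩⟩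
    · rw [List.length_append, List.length_singleton]; omega
    · intro l hl
      rcases List.mem_append.mp hl with hl | hl
      · rw [List.mem_singleton.mp hl]; exact hcmem
      · exact hLCmem l hl
    · rw [walkEnd_flatten_append, hen1]; exact hLCend
    · refine links_append _ _ _ (cons_single _ _ hst1) fun pre post l h => ?_
      rw [hen1]; exact hLCcons pre post l h
    · rw [List.length_append, List.length_singleton]; omega
    · intro l hl
      rcases List.mem_append.mp hl with hl | hl
      · exact hLBmem l hl
      · rw [List.mem_singleton.mp hl]; exact hcmem
    · rw [walkEnd_flatten_append, hLBend]; exact hen2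
    · refine links_append _ _ _ hLBcons fun pre post l h => ?_
      rw [hLBend]; exact cons_single _ _ hst2 pre post l h

end RootCentre

/-! ## §2 Centre ⇝ centre and the root chains, graded -/

section Main

variable {M₁ k : ℕ} {Z : Set (Site P 0)}

/-- ★★ **(graded) CENTRE ⇝ CENTRE ACROSS A FINE BOND** — `N12BjRootChains.exists_chain_centre_centre` with `|J − J′| ≤ 1` EXPORTED and the LEVEL GRADE `≤ J + 1`, `≤ J′ + 1` of every link recorded.  For a fine bond `b` whose ends have member blocks of levels `J ≥ 1` and `J′`: the centres `ι_J(B^J b₋)`, `ι_{J′}(B^{J′} b₊)` are EQUAL, or the two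
blocks are adjacent members of the same level (one member `J`-bond), or `|J − J′| = 1` and the bond crosses `∂Ω_{max}`: one member bond of the larger level to the outside neighbour block and a
path of members of the smaller level inside it (`exists_chain_across`; `|J − J′| ≤ 1` by the collar).  A chain of `≤ d·(L−1)∕2 + 1` member links.
[cite: Balaban1988Convergent, (2.2) p.255, (2.13) pp.256–257; Balaban1985Variational, (16)–(18) p.280] -/
theorem exists_chain_centre_centre_graded (hM2 : 2 ≤ M₁) (hdiv : side P.L M₁ k ∣ P.sitesPerDir 0) (hk : k ≤ P.m + P.K) (b : PBond P 0) {J J' : ℕ} (hJ1 : 1 ≤ J)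
    (hJ : iterBlockOf J b.src ∈ (Bj M₁ Z k : DetSet P) J) (hJ' : iterBlockOf J' b.tgt ∈ (Bj M₁ Z k : DetSet P) J') :
    (J ≤ J' + 1 ∧ J' ≤ J + 1) ∧ ∃ links : List ((m : ℕ) × (PBond P m × Bool)), links.length ≤ P.d * ((P.L - 1) / 2) + 1 ∧
      (∀ l ∈ links, l.1 ≤ J + 1 ∧ l.1 ≤ J' + 1 ∧ l.1 ≤ k ∧ l.2.1 ∈ bondsOf ((Bj M₁ Z k : DetSet P) l.1)) ∧
      walkEnd (embIter J (iterBlockOf J b.src)) (links.map fun l => List.replicate (P.L ^ l.1) (l.2.1.dir, l.2.2)).flatten = embIter J' (iterBlockOf J' b.tgt) ∧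
      ∀ (pre post : List ((m : ℕ) × (PBond P m × Bool))) (l : (m : ℕ) × (PBond P m × Bool)), links = pre ++ l :: post →
        (l.2.2 = true → walkEnd (embIter J (iterBlockOf J b.src)) (pre.map fun l => List.replicate (P.L ^ l.1) (l.2.1.dir, l.2.2)).flatten = embIter l.1 l.2.1.src) ∧
        (l.2.2 = false → walkEnd (embIter J (iterBlockOf J b.src)) (pre.map fun l => List.replicate (P.L ^ l.1) (l.2.1.dir, l.2.2)).flatten = embIter l.1 l.2.1.tgt) := by
  have hM : 1 ≤ M₁ := by omega
  have hJk : J ≤ k := le_of_iterBlockOf_mem_Bj hJ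
  have htgt : (b.tgt : Site P 0) = b.src.shift b.dir := rfl
  have hsΩ : b.src ∈ maxDomT M₁ Z J := mem_maxDomT_of_iterBlockOf_mem_Bj hM hdiv hk hJ1 hJ
  have hor : iterBlockOf J b.tgt = iterBlockOf J b.src ∨ iterBlockOf J b.tgt = (iterBlockOf J b.src).shift b.dir := by
    rw [htgt]; exact iterBlockOf_shift_or J (hJk.trans hk) b.src b.dir
  by_cases htJ : iterBlockOf J b.tgt ∈ (Bj M₁ Z k : DetSet P) J
  · -- same level
    have hJJ' : J = J' := eq_of_iterBlockOf_mem_Bj hM hdiv hk htJ hJ'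
    subst hJJ'
    rcases hor with heq | hsh
    · refine ⟨⟨Nat.le_succ J, Nat.le_succ J⟩, [], by simp, fun l hl => absurd hl List.not_mem_nil, by rw [heq]; rfl, fun pre post l h => ?_⟩
      simp at h
    · have hst : ((⟨J, ⟨iterBlockOf J b.src, b.dir⟩, true⟩ : (m : ℕ) × (PBond P m × Bool)).2.2 = true →
            embIter J (iterBlockOf J b.src) = embIter J (PBond.src ⟨iterBlockOf J b.src, b.dir⟩)) ∧
          ((⟨J, ⟨iterBlockOf J b.src, b.dir⟩, true⟩ : (m : ℕ) × (PBond P m × Bool)).2.2 = false →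
            embIter J (iterBlockOf J b.src) = embIter J (PBond.tgt ⟨iterBlockOf J b.src, b.dir⟩)) := ⟨fun _ => rfl, fun h => absurd h (by simp)⟩
      refine ⟨⟨Nat.le_succ J, Nat.le_succ J⟩, [⟨J, ⟨iterBlockOf J b.src, b.dir⟩, true⟩], by simp, fun l hl => ?_, ?_, cons_single _ _ hst⟩
      · rw [List.mem_singleton.mp hl]; exact ⟨Nat.le_succ J, Nat.le_succ J, hJk, Or.inl hJ⟩
      · rw [walkEnd_single _ _ hst, hsh]; simp; rfl
  · by_cases htΩ : b.tgt ∈ maxDomT M₁ Z J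
    · -- `b₊ ∈ Ω_J` with a non-member `J`-block: `b₊ ∈ Ω_{J+1}`, `J′ = J + 1`, and `b₋ ∉ Ω_{J+1}`
      have hUJ := B14.Eq213DetSet.isBlockUnion_maxDomT hM (Ω := Z) hdiv hJ1 hJk (hJk.trans hk)
      have hJk' : J < k := by
        by_contra h
        have hJk2 : J = k := le_antisymm hJk (not_lt.mp h)
        subst hJk2
        apply htJ
        rw [Bj_top]
        have h1 := (hUJ b.tgt).1 htΩ
        rw [N12FlatHndRecordLetters.blockIter_eq_iterBlockOf] at h1
        exact h1
      have htΩ1 : b.tgt ∈ maxDomT M₁ Z (J + 1) := by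
        by_contra h1
        apply htJ
        rw [Bj_mid (by omega) hJk']
        refine ⟨?_, fun h2 => h1 ?_⟩
        · have h3 := (hUJ b.tgt).1 htΩ
          rw [N12FlatHndRecordLetters.blockIter_eq_iterBlockOf] at h3
          exact h3
        · have hU1 := B14.Eq213DetSet.isBlockUnion_maxDomT_succ hM (Ω := Z) hdiv (show J + 1 ≤ k by omega) (hJk.trans hk)
          rw [hU1 b.tgt, N12FlatHndRecordLetters.blockIter_eq_iterBlockOf]
          exact h2
      have hJ'1 : 1 ≤ J' := by
        by_contra h0
        have hJ'0 : J' = 0 := by omega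
        subst hJ'0
        rw [Bj_zero (by omega)] at hJ'
        exact hJ' (maxDomT_antitone hM Z (by omega : 1 ≤ J + 1) htΩ1)
      have hge : J + 1 ≤ J' := by
        by_contra h
        exact not_mem_maxDomT_of_iterBlockOf_mem_Bj hM hdiv hk (show J' < J + 1 by omega) (by omega) hJ' htΩ1
      have hle : J' ≤ J + 1 := by
        by_contra h
        have htΩ' : b.tgt ∈ maxDomT M₁ Z J' := mem_maxDomT_of_iterBlockOf_mem_Bj hM hdiv hk hJ'1 hJ'
        have hJ'k : J' ≤ k := le_of_iterBlockOf_mem_Bj hJ'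
        have hsΩ' : b.src ∈ maxDomT M₁ Z (J' - 1) :=
          mem_maxDomT_pred_of_blockIdx hM2 hdiv hk hJ'1 (le_of_iterBlockOf_mem_Bj hJ') (i := 0) (Nat.zero_le _) htΩ'
            (fun κ => idx_adj_of_bond b (Or.inr rfl) (Or.inl rfl) κ)
        exact not_mem_maxDomT_of_iterBlockOf_mem_Bj hM hdiv hk (show J < J' - 1 by omega) (by omega) hJ hsΩ'
      have hJ'eq : J' = J + 1 := le_antisymm hle hge
      subst hJ'eq
      have hsΩ1 : b.src ∉ maxDomT M₁ Z (J + 1) := not_mem_maxDomT_of_iterBlockOf_mem_Bj hM hdiv hk (Nat.lt_succ_self J) (by omega) hJ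
      have hor1 : iterBlockOf (J + 1) b.tgt = iterBlockOf (J + 1) b.src ∨ iterBlockOf (J + 1) b.tgt = (iterBlockOf (J + 1) b.src).shift b.dir := by
        rw [htgt]; exact iterBlockOf_shift_or (J + 1) (by omega) b.src b.dir
      have hne1 : iterBlockOf (J + 1) b.tgt ≠ iterBlockOf (J + 1) b.src := iterBlockOf_ne_of_mem_not_mem hM2 hdiv hk (by omega) (by omega) htΩ1 hsΩ1
      have hsh1 : iterBlockOf (J + 1) b.tgt = (iterBlockOf (J + 1) b.src).shift b.dir := hor1.resolve_left hne1
      obtain ⟨-, -, ⟨links, hlen, hmem, hend, hcons⟩⟩ := exists_chain_across_graded hM2 hdiv hk (n := J) (by omega) hJ' hsΩ1 ⟨iterBlockOf (J + 1) b.src, b.dir⟩ (Or.inr ⟨hsh1.symm, rfl⟩)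
      exact ⟨⟨by omega, by omega⟩, links, hlen, fun l hl => ⟨(hmem l hl).1, (hmem l hl).1.trans (Nat.le_succ _), (hmem l hl).2⟩, hend, hcons⟩
    · -- `b₊ ∉ Ω_J`: `J′ = J − 1`
      obtain ⟨n, rfl⟩ : ∃ n, J = n + 1 := ⟨J - 1, by omega⟩
      have hne : iterBlockOf (n + 1) b.tgt ≠ iterBlockOf (n + 1) b.src := (iterBlockOf_ne_of_mem_not_mem hM2 hdiv hk hJ1 hJk hsΩ htΩ).symm
      have hsh : iterBlockOf (n + 1) b.tgt = (iterBlockOf (n + 1) b.src).shift b.dir := hor.resolve_left hne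
      obtain ⟨hmemt, ⟨links, hlen, hmem, hend, hcons⟩, -⟩ := exists_chain_across_graded hM2 hdiv hk (n := n) hJk hJ htΩ ⟨iterBlockOf (n + 1) b.src, b.dir⟩ (Or.inl ⟨rfl, hsh.symm⟩)
      have hJ'eq : J' = n := eq_of_iterBlockOf_mem_Bj hM hdiv hk hJ' hmemt
      subst hJ'eq
      exact ⟨⟨by omega, by omega⟩, links, hlen, fun l hl => ⟨(hmem l hl).1.trans (Nat.le_succ _), (hmem l hl).1, (hmem l hl).2⟩, hend, hcons⟩

/-- ★★★ **(graded) (G-c) THE ROOT CHAINS OF `𝐁_k(Z)`** — `N12BjRootChains.exists_rootChain_Bj` with the `Γ`-levels `J`, `J′` of the two ends as INPUTS and the LEVEL GRADE `≤ J + 1`, `≤ J′ + 1` of every link recorded (dag-n12-w6's LOCATED-GRADING: per-bond transporter budgets `∼ L^{J+1}`).  `1 ≤ k ≤ m + K`, `M₁ ≥ 2`, cover divisibility; `root` any root map with p635000's (CENTRE) clause (the rooted tower forest of the record).  For EVERY fine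
bond `b` with both ends in `Ω₁(Z)` there is a chain of `≤ 3·d·(L−1)∕2 + 5` links `⟨i, c, ±⟩`, each a MEMBER bond `c ∈ bondsOf 𝐁_k(Z)_i` of level `i ≤ k` traversed forward or backward,
whose straight fine segment words (`L^i` letters `(dir c, ±)`) are CONSECUTIVE from `root b₋` — read in the addressing `links = pre ++ l :: post`, the segments of `pre` end at `ι_i c₋`
(forward) ∕ `ι_i c₊` (backward) — and END at `root b₊`: the datum `Ω` of dag-n12-w6's root-transporter letter `hT`, in the shape of `T4ForestGaugeCorridorBound.dist1_holAt_chain_mul_prod_inv_le`.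
[cite: Balaban1988Convergent, (2.2) p.255, (2.13) pp.256–257; Balaban1985Variational, (3)–(4) p.278, (16)–(18) p.280; Balaban1985RegularSpaces, (1.19) p.79] -/
theorem exists_rootChain_Bj_graded (hk : k ≤ P.m + P.K) (hk1 : 1 ≤ k) (hM2 : 2 ≤ M₁) (hdiv : side P.L M₁ k ∣ P.sitesPerDir 0) (root : Site P 0 → Site P 0)
    (hcentre : ∀ (z : Site P 0) (J : ℕ), iterBlockOf J z ∈ (Bj M₁ Z k : DetSet P) J →
      ((1 ≤ J ∧ ∃ c ∈ bondsOf ((Bj M₁ Z k : DetSet P) (J - 1)), (iterBlockOf (J - 1) z = c.src ∨ iterBlockOf (J - 1) z = c.tgt)) ∧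
          root z = embIter (J - 1) (iterBlockOf (J - 1) z)) ∨
      (¬ (1 ≤ J ∧ ∃ c ∈ bondsOf ((Bj M₁ Z k : DetSet P) (J - 1)), (iterBlockOf (J - 1) z = c.src ∨ iterBlockOf (J - 1) z = c.tgt)) ∧
          root z = embIter J (iterBlockOf J z)))
    (b : PBond P 0) (hbs : b.src ∈ maxDomT M₁ Z 1) (hbt : b.tgt ∈ maxDomT M₁ Z 1)
    {J J' : ℕ} (hJ : iterBlockOf J b.src ∈ (Bj M₁ Z k : DetSet P) J) (hJ' : iterBlockOf J' b.tgt ∈ (Bj M₁ Z k : DetSet P) J') :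
    ∃ links : List ((m : ℕ) × (PBond P m × Bool)), links.length ≤ 3 * (P.d * ((P.L - 1) / 2)) + 5 ∧
      (∀ l ∈ links, l.1 ≤ k ∧ l.2.1 ∈ bondsOf ((Bj M₁ Z k : DetSet P) l.1)) ∧
      (∀ l ∈ links, l.1 ≤ J + 1 ∧ l.1 ≤ J' + 1) ∧
      walkEnd (root b.src) (links.map fun l => List.replicate (P.L ^ l.1) (l.2.1.dir, l.2.2)).flatten = root b.tgt ∧
      ∀ (pre post : List ((m : ℕ) × (PBond P m × Bool))) (l : (m : ℕ) × (PBond P m × Bool)), links = pre ++ l :: post →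
        (l.2.2 = true → walkEnd (root b.src) (pre.map fun l => List.replicate (P.L ^ l.1) (l.2.1.dir, l.2.2)).flatten = embIter l.1 l.2.1.src) ∧
        (l.2.2 = false → walkEnd (root b.src) (pre.map fun l => List.replicate (P.L ^ l.1) (l.2.1.dir, l.2.2)).flatten = embIter l.1 l.2.1.tgt) := by
  have hM : 1 ≤ M₁ := by omega
  have hlev : ∀ {z : Site P 0} {I : ℕ}, z ∈ maxDomT M₁ Z 1 → iterBlockOf I z ∈ (Bj M₁ Z k : DetSet P) I → 1 ≤ I := fun {z I} hz hI => by
    by_contra h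
    have hI0 : I = 0 := by omega
    subst hI0
    rw [Bj_zero (by omega)] at hI
    exact hI hz
  have hJ1 := hlev hbs hJ
  have hJ'1 := hlev hbt hJ'
  obtain ⟨⟨L₁, h1len, h1mem, h1end, h1cons⟩, -⟩ := exists_chain_root_centre_graded hM2 hdiv hk hJ1 hJ root (hcentre b.src J hJ)
  obtain ⟨⟨hJJ1, hJJ2⟩, L₂, h2len, h2mem, h2end, h2cons⟩ := exists_chain_centre_centre_graded hM2 hdiv hk b hJ1 hJ hJ'
  obtain ⟨-, ⟨L₃, h3len, h3mem, h3end, h3cons⟩⟩ := exists_chain_root_centre_graded hM2 hdiv hk hJ'1 hJ' root (hcentre b.tgt J' hJ')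
  have h12end : walkEnd (root b.src) ((L₁ ++ L₂).map fun l => List.replicate (P.L ^ l.1) (l.2.1.dir, l.2.2)).flatten = embIter J' (iterBlockOf J' b.tgt) := by
    rw [walkEnd_flatten_append, h1end, h2end]
  refine ⟨(L₁ ++ L₂) ++ L₃, ?_, ?_, ?_, ?_, ?_⟩
  · rw [List.length_append, List.length_append]; omega
  · intro l hl
    rcases List.mem_append.mp hl with hl | hl
    · rcases List.mem_append.mp hl with hl | hl
      · exact (h1mem l hl).2
      · exact (h2mem l hl).2.2
    · exact (h3mem l hl).2
  · intro l hl
    rcases List.mem_append.mp hl with hl | hl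
    · rcases List.mem_append.mp hl with hl | hl
      · have h := (h1mem l hl).1
        exact ⟨h.trans (Nat.le_succ J), by omega⟩
      · exact ⟨(h2mem l hl).1, (h2mem l hl).2.1⟩
    · have h := (h3mem l hl).1
      exact ⟨by omega, h.trans (Nat.le_succ J')⟩
  · rw [walkEnd_flatten_append, h12end, h3end]
  · refine links_append _ _ _ (links_append _ _ _ h1cons fun pre post l h => ?_) fun pre post l h => ?_
    · rw [h1end]; exact h2cons pre post l h
    · rw [h12end]; exact h3cons pre post l h

end Main

end Summit.QuantumFields.YangMills.BalabanUVNodes.N12BjRootChainsGraded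

end
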